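import Summits.QuantumAdvantage.AdviceFreeQNC0.SeedJuntaSlack39Walk
import HarnessLib

/-!
# Cell qa-qnc0, `p = 3` — TWO TOLERANCE SETS: the structured branch needs the seeds spread only off `W ∪ {high co-degree letters}`;
# no slack, no budget change, plain level-`C` schedule (prover qn-prover-3 g27; sequel of `SeedJuntaSlack39B` / `SeedJuntaSlack39Walk`)

The slack theorems of `SeedJuntaSlack39/39B` pay `N/(log₂N)^E` in the seed schedule to guarantee that the seeds stay graded-spread off the
ENLARGED tolerance set.  The reduction itself never needs that guarantee in schedule form: its main term (`AffBells34.coverPolylogHard`) sees the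
tolerance set `W` of the juntas (budget `3·#W ≤ N`), while the graded twisted terms may be estimated at ANY larger set `W' ⊇ W` off which the
seeds are graded-spread — `W'` carries NO budget.  With `W' := W ∪ H`, `H` = the letters outside `W` of co-read degree `≥ (log₂N)^C` in the junta
family, the co-degree form of (R1) (`AffBells22.norm_twistedWinSum_le_of_coDegree`, budget-free) applies off `W'`.  Hence:

* §1 **`GradedSeeds38.seedJuntaHard_of_twoTolR1`** — the graded-seed reduction with TWO tolerance sets: main term at `W`, spread and twisted
  bound at `W' ⊇ W` (restricted-(R1) hypothesis WITHOUT budget on `W'`, admissibility predicate `Q C N W' T`); proof =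
  `seedJuntaHard_of_restrictedR1C` verbatim.  `GradedSeeds38.twistedBound_coDegree_noBudget` — the co-degree (R1) instance without the idle budget
  hypothesis of `twistedJuntaBoundX3S_of_coDegree`.
* §2 ★★ **`GradedSeeds38.seedJuntaHardXS_twoTol`** — ONE `θ < 1`; ∀`C` ∃`D, n₀`: `W ⊆ W'`, `3·#W ≤ N`, seeds graded-spread off `W'` with the PLAIN
  schedule `(log₂N)^C·(50(j+1) + D·log₂N)`, juntas `#(T k ∖ W) ≤ (log₂N)^C`, co-degrees off `W'` `< (log₂N)^C` ⇒ `≤ θ·2^{N−1}` — and its user form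
  ★★ **`GradedSeeds38.seedJuntaHardXS_offHigh`**: `W' := W ∪ highCoDeg` chosen for you — *the structured branch holds, unconditionally and with the
  plain schedule, as soon as the seeds are graded-spread off `W` AND off the letters of co-degree `≥ (log₂N)^C` in the junta family* (arbitrary
  overlaps otherwise).  The slack theorem `seedJuntaHardXS_slack'` is the instance "spread off `W` with slack `≥ #highCoDeg`"; families whose seeds
  avoid the high-co-degree letters (e.g. dense generic seeds) need no slack at all.
* §3 ★ **`GradedSeeds38.perOutputForms_structured_twoTol`** — the (J3)ˣ form (canonical guess, `r` private forms per output): decomposition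
  `ℓ_{k,i} = Σ_t a_{k,i,t} c_t + rem_{k,i}`, remainder juntas `T k`, any `W' ⊇ W` with co-degrees `< (log₂N)^C` off `W'` and `c` graded-spread off
  `W'` (plain schedule), `#(⋃_i supp rem_{k,i}∖W) + 2 ≤ (log₂N)^C` ⇒ θ-hard.

WHAT THIS IS NOT: nothing on case (B) (heavy remainders) nor on seeds that concentrate on the high-co-degree letters (there the slack form or (R1) in
the dense-overlap regime is needed); crux `stmt-QuantumAdvantage-22907` untouched; no ledger item (D-0168 shelf).
-/

noncomputable section

namespace Summit.QuantumAdvantage.AdviceFreeQNC0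

open Finset Literature.Computability.QuantumComplexity Literature.Computability.QuantumComplexity.RingHLF
open Literature.Computability.MetaComplexity

namespace GradedSeeds38

open TwistedJunta36 AffBells22

/-! ## §1 The two-tolerance reduction and the budget-free co-degree instance -/

section TwoTol

open scoped Classical in
/-- **Graded-seed reduction with TWO tolerance sets.**  Main term at `W` (`3·#W ≤ N`, juntas `#(T k ∖ W) ≤ (log₂N)^C`, cover-hardness constant
`θ` passed explicitly as `hcover` = the body of `AffBells34.coverPolylogHard`); graded spread and the restricted twisted bound at any `W' ⊇ W`
(hypothesis `hTJ`: (R1)-shape off `W'` for juntas small off `W'` and admissible pairs `Q C N W' T`, NO budget on `W'`).  Conclusion: seed ⊕ junta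
strategies win on `≤ ((1+θ)/2)·2^{N−1}` odd inputs.  Proof = `seedJuntaHard_of_restrictedR1C` verbatim. -/
theorem seedJuntaHard_of_twoTolR1 (Q : ℕ → (N : ℕ) → Finset (Fin N) → (Fin N → Finset (Fin N)) → Prop)
    {θ : ℝ} (hθ : θ < 1)
    (hcover : ∀ C : ℕ, ∃ n₀ : ℕ, ∀ N ≥ n₀,
      ∀ (W : Finset (Fin N)) (T : Fin N → Finset (Fin N)) (g : Fin N → (Fin N → Bool) → Bool),
        3 * W.card ≤ N → (∀ k, (T k \ W).card ≤ (Nat.log 2 N) ^ C) → (∀ k, ReadsOnly (T k) (g k)) →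
          (winCount (fun x k => g k x) : ℝ) ≤ θ * (2 : ℝ) ^ (N - 1))
    {ρ : ℝ} {α : ℕ} (hρ : 0 ≤ ρ) (hq : 3 * ρ ^ α < 1)
    (hTJ : ∀ C : ℕ, ∃ A n₀ : ℕ, ∀ N ≥ n₀,
      ∀ (W' : Finset (Fin N)) (T : Fin N → Finset (Fin N)) (g : Fin N → (Fin N → Bool) → Bool),
        (∀ k, (T k \ W').card ≤ (Nat.log 2 N) ^ C) → Q C N W' T →
        (∀ k (x x' : Fin N → Bool), (∀ i ∈ T k, x i = x' i) → g k x = g k x') →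
          ∀ β : Fin N → ZMod 3,
            ‖∑ x : Fin N → Bool, (ZMod.stdAddChar (∑ i : Fin N, if x i then β i else 0) : ℂ) *
                (if (OddZeros x ∧ RingHLF.Rel x (fun k => g k x)) then (1 : ℂ) else 0)‖
              ≤ (N : ℝ) ^ A * ρ ^ ((univ.filter fun i : Fin N => i ∉ W' ∧ β i ≠ 0).card / (Nat.log 2 N) ^ C) * (2 : ℝ) ^ N) :
    ∀ C : ℕ, ∃ D n₀ : ℕ, ∀ N ≥ n₀,
      ∀ (W W' : Finset (Fin N)) (R : ℕ) (c : Fin R → Fin N → ZMod 3) (T : Fin N → Finset (Fin N))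
        (H : Fin N → (Fin R → ZMod 3) → (Fin N → Bool) → Bool),
        W ⊆ W' → 3 * W.card ≤ N → GradedSpreadOff W' c (fun j => (Nat.log 2 N) ^ C * (α * (j.val + 1) + D * Nat.log 2 N)) →
        (∀ k, (T k \ W).card ≤ (Nat.log 2 N) ^ C) → Q C N W' T →
        (∀ k v (x x' : Fin N → Bool), (∀ i ∈ T k, x i = x' i) → H k v x = H k v x') →
          ((univ.filter fun x : Fin N → Bool =>
              OddZeros x ∧ RingHLF.Rel x (fun k => H k (LinForms.resVec c x) x)).card : ℝ)
            ≤ (1 + θ) / 2 * (2 : ℝ) ^ (N - 1) := by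
  classical
  intro C
  obtain ⟨n₁, hn₁⟩ := hcover C
  obtain ⟨A, n₂, hn₂⟩ := hTJ C
  have hρα0 : 0 ≤ ρ ^ α := pow_nonneg hρ α
  have hq0 : 0 ≤ 3 * ρ ^ α := by positivity
  have hρα : ρ ^ α ≤ 1 / 2 := by linarith
  have hρ1 : ρ ≤ 1 := by
    by_contra h
    have h1 : 1 ≤ ρ ^ α := one_le_pow₀ (le_of_lt (not_le.1 h))
    linarith
  have h1θ : 0 < (1 - θ) / 2 := by linarith
  obtain ⟨n₃, hn₃⟩ : ∃ n₃ : ℕ, (2 : ℝ) ^ (A + 2) * (3 * ρ ^ α / (1 - 3 * ρ ^ α)) / ((1 - θ) / 2) ≤ n₃ :=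
    ⟨_, Nat.le_ceil _⟩
  refine ⟨α * (A + 1), max (max n₁ n₂) (max n₃ 2), fun N hN W W' R c T H hWW' hW hspread hT hQ hH => ?_⟩
  have hN1 : n₁ ≤ N := le_trans (le_trans (le_max_left _ _) (le_max_left _ _)) hN
  have hN2 : n₂ ≤ N := le_trans (le_trans (le_max_right _ _) (le_max_left _ _)) hN
  have hN3 : n₃ ≤ N := le_trans (le_trans (le_max_left _ _) (le_max_right _ _)) hN
  have hNtwo : 2 ≤ N := le_trans (le_trans (le_max_right _ _) (le_max_right _ _)) hN
  have hNone : 1 ≤ N := by omega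
  have hNpos : (0 : ℝ) < N := by exact_mod_cast hNone
  -- the juntas are small off `W'` as well
  have hT' : ∀ k, (T k \ W').card ≤ (Nat.log 2 N) ^ C := fun k =>
    le_trans (card_le_card (sdiff_subset_sdiff (subset_refl _) hWW')) (hT k)
  set L : ℕ := Nat.log 2 N with hL
  set P : (Fin R → ZMod 3) → (Fin N → Bool) → Prop := fun v x =>
    OddZeros x ∧ RingHLF.Rel x (fun k => H k v x) with hP
  set Bj : Fin R → ℝ := fun j => (N : ℝ) ^ A * ρ ^ (α * (j.val + 1) + α * (A + 1) * L) * (2 : ℝ) ^ N with hBj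
  have hBj0 : ∀ j, 0 ≤ Bj j := fun j => by positivity
  -- (a) main term at the tolerance set `W`
  have ha : ∀ v : Fin R → ZMod 3,
      ∑ x : Fin N → Bool, (if P v x then (1 : ℝ) else 0) ≤ θ * (2 : ℝ) ^ (N - 1) := by
    intro v
    have h := hn₁ N hN1 W T (fun k x => H k v x) hW hT (fun k => fun x x' hxx' => hH k v x x' hxx')
    rw [sum_boole]
    simpa [AffBells22.winCount, hP] using h
  -- (b) graded twisted sums at the tolerance set `W'`
  have hb : ∀ (v γ : Fin R → ZMod 3) (j : Fin R), IsTop γ j →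
      ‖∑ x : Fin N → Bool, (ZMod.stdAddChar (∑ i, γ i * LinForms.resVec c x i) : ℂ) *
          ((if P v x then (1 : ℝ) else 0 : ℝ) : ℂ)‖ ≤ Bj j := by
    intro v γ j hj
    set β : Fin N → ZMod 3 := fun m => ∑ i, γ i * c i m with hβ
    have hres : ∀ x : Fin N → Bool, ∑ i, γ i * LinForms.resVec c x i = ∑ m, if x m then β m else 0 := by
      intro x
      simp only [LinForms.resVec, hβ, mul_sum]
      rw [sum_comm]
      refine sum_congr rfl fun m _ => ?_
      split_ifs <;> simp
    have h := hn₂ N hN2 W' T (fun k x => H k v x) hT' hQ (fun k x x' hxx' => hH k v x x' hxx') β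
    have hcast : ∀ x : Fin N → Bool, (((if P v x then (1 : ℝ) else 0 : ℝ)) : ℂ) = (if P v x then (1 : ℂ) else 0) := by
      intro x; split_ifs <;> simp
    simp_rw [hres, hcast]
    refine le_trans (by simpa [hP] using h) ?_
    have hLC : 0 < L ^ C := by
      have hL1 : 1 ≤ L := by rw [hL]; exact Nat.le_log_of_pow_le (by norm_num) (by simpa using hNtwo)
      exact pow_pos (by omega) C
    have hw0 : L ^ C * (α * (j.val + 1) + α * (A + 1) * L) ≤ (univ.filter fun i : Fin N => i ∉ W' ∧ β i ≠ 0).card :=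
      hspread γ j hj
    have hw : α * (j.val + 1) + α * (A + 1) * L ≤ (univ.filter fun i : Fin N => i ∉ W' ∧ β i ≠ 0).card / L ^ C := by
      rw [Nat.le_div_iff_mul_le hLC, mul_comm]; exact hw0
    calc (N : ℝ) ^ A * ρ ^ ((univ.filter fun i : Fin N => i ∉ W' ∧ β i ≠ 0).card / L ^ C) * (2 : ℝ) ^ N
        ≤ (N : ℝ) ^ A * ρ ^ (α * (j.val + 1) + α * (A + 1) * L) * (2 : ℝ) ^ N := by
          gcongr _ * ?_ * _
          exact pow_le_pow_of_le_one hρ hρ1 hw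
      _ = Bj j := rfl
  have hmain := sum_le_max_add_graded (p := 3) (fun x : Fin N → Bool => LinForms.resVec c x)
    (fun v x => if P v x then (1 : ℝ) else 0) (θ * (2 : ℝ) ^ (N - 1)) Bj hBj0 ha hb
  have hset : ((univ.filter fun x : Fin N → Bool =>
      OddZeros x ∧ RingHLF.Rel x (fun k => H k (LinForms.resVec c x) x)).card : ℝ)
      = ∑ x : Fin N → Bool, (if P (LinForms.resVec c x) x then (1 : ℝ) else 0) := by
    rw [sum_boole]
  rw [hset]
  refine hmain.trans ?_
  -- (c) the error term `Σ_j 3^{j+1} Bj j ≤ ((1-θ)/2)·2^{N-1}`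
  have herr : ∑ j : Fin R, ((3 : ℕ) : ℝ) ^ (j.val + 1) * Bj j ≤ ((1 - θ) / 2) * (2 : ℝ) ^ (N - 1) := by
    have hterm : ∀ j : Fin R, ((3 : ℕ) : ℝ) ^ (j.val + 1) * Bj j =
        (3 * ρ ^ α) ^ (j.val + 1) * ((N : ℝ) ^ A * (ρ ^ α) ^ ((A + 1) * L) * (2 : ℝ) ^ N) := by
      intro j
      have e1 : ρ ^ (α * (j.val + 1) + α * (A + 1) * L) = (ρ ^ α) ^ (j.val + 1) * (ρ ^ α) ^ ((A + 1) * L) := by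
        rw [pow_add, pow_mul, mul_assoc, pow_mul]
      have eB : Bj j = (N : ℝ) ^ A * ρ ^ (α * (j.val + 1) + α * (A + 1) * L) * (2 : ℝ) ^ N := rfl
      rw [eB, e1, mul_pow]; push_cast; ring
    rw [sum_congr rfl fun j _ => hterm j, ← sum_mul]
    have hN2 : (2 : ℝ) ^ N = 2 * (2 : ℝ) ^ (N - 1) := by
      rw [← pow_succ']; congr 1; omega
    have hgeo := sum_pow_succ_le_div (3 * ρ ^ α) hq0 hq R
    have hdec := pow_mul_decay_le N A hNone (ρ ^ α) hρα0 hρα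
    have hq1 : 0 < 1 - 3 * ρ ^ α := by linarith
    have hK0 : 0 ≤ 3 * ρ ^ α / (1 - 3 * ρ ^ α) := div_nonneg hq0 hq1.le
    have hp : (0 : ℝ) ≤ (2 : ℝ) ^ (N - 1) := by positivity
    have hN3' : (2 : ℝ) ^ (A + 2) * (3 * ρ ^ α / (1 - 3 * ρ ^ α)) / ((1 - θ) / 2) ≤ N :=
      hn₃.trans (by exact_mod_cast hN3)
    have hkey : (2 : ℝ) ^ (A + 2) * (3 * ρ ^ α / (1 - 3 * ρ ^ α)) / N ≤ (1 - θ) / 2 := by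
      rw [div_le_iff₀ hNpos]
      rw [div_le_iff₀ h1θ] at hN3'
      linarith
    calc (∑ j : Fin R, (3 * ρ ^ α) ^ (j.val + 1)) * ((N : ℝ) ^ A * (ρ ^ α) ^ ((A + 1) * L) * (2 : ℝ) ^ N)
        ≤ (3 * ρ ^ α / (1 - 3 * ρ ^ α)) * ((2 : ℝ) ^ (A + 1) / N * (2 : ℝ) ^ N) := by
          refine mul_le_mul hgeo ?_ (by positivity) hK0
          exact mul_le_mul_of_nonneg_right hdec (by positivity)
      _ = ((2 : ℝ) ^ (A + 2) * (3 * ρ ^ α / (1 - 3 * ρ ^ α)) / N) * (2 : ℝ) ^ (N - 1) := by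
          rw [hN2]; ring
      _ ≤ ((1 - θ) / 2) * (2 : ℝ) ^ (N - 1) := mul_le_mul_of_nonneg_right hkey hp
  have h3 : ∑ j : Fin R, ((3 : ℕ) : ℝ) ^ (j.val + 1) * Bj j = ∑ j : Fin R, (3 : ℝ) ^ (j.val + 1) * Bj j := by
    push_cast; rfl
  linarith [herr]

end TwoTol

open scoped Classical in
/-- The co-degree form of (R1) (`R1CoDegree39`) in the budget-free hypothesis format of `seedJuntaHard_of_twoTolR1` (`A = 1`, `n₀ = 3`):
juntas `#(T k ∖ W') ≤ (log₂N)^C`, every letter outside `W'` with `< (log₂N)^C` co-read partners outside `W'` — no condition on `#W'`. -/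
theorem twistedBound_coDegree_noBudget (C : ℕ) :
    ∃ A n₀ : ℕ, ∀ N ≥ n₀,
      ∀ (W' : Finset (Fin N)) (T : Fin N → Finset (Fin N)) (g : Fin N → (Fin N → Bool) → Bool),
        (∀ k, (T k \ W').card ≤ (Nat.log 2 N) ^ C) →
        (∀ i : Fin N, i ∉ W' →
          (univ.filter fun i' : Fin N => i' ≠ i ∧ i' ∉ W' ∧ ∃ k, i ∈ T k ∧ i' ∈ T k).card + 1 ≤ (Nat.log 2 N) ^ C) →
        (∀ k (x x' : Fin N → Bool), (∀ i ∈ T k, x i = x' i) → g k x = g k x') →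
          ∀ β : Fin N → ZMod 3,
            ‖∑ x : Fin N → Bool, (ZMod.stdAddChar (∑ i : Fin N, if x i then β i else 0) : ℂ) *
                (if (OddZeros x ∧ RingHLF.Rel x (fun k => g k x)) then (1 : ℂ) else 0)‖
              ≤ (N : ℝ) ^ A * (39 / 40 : ℝ) ^ ((univ.filter fun i : Fin N => i ∉ W' ∧ β i ≠ 0).card / (Nat.log 2 N) ^ C)
                  * (2 : ℝ) ^ N := by
  classical
  refine ⟨1, 3, fun N hN W' T g _hT hco hg β => ?_⟩
  have hTr : ∀ k, ReadsOnly (T k) (g k) := fun k x x' h => hg k x x' h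
  have hco' : ∀ i : Fin N, i ∉ W' →
      (univ.filter fun i' : Fin N => i' ≠ i ∧ i' ∉ W' ∧ ∃ k, i ∈ T k ∧ i' ∈ T k).card ≤ (Nat.log 2 N) ^ C - 1 := by
    intro i hi; have := hco i hi; omega
  have hs : 1 ≤ (Nat.log 2 N) ^ C := Nat.one_le_pow _ _ (Nat.le_log_of_pow_le (by norm_num) (by omega))
  have h := norm_twistedWinSum_le_of_coDegree hN W' T g hTr ((Nat.log 2 N) ^ C - 1) hco' β
  have hΔ1 : (Nat.log 2 N) ^ C - 1 + 1 = (Nat.log 2 N) ^ C := by omega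
  rw [hΔ1] at h
  rw [pow_one]
  refine h.trans ?_
  have hN2 : (2 : ℝ) ≤ (N : ℝ) := by exact_mod_cast (show 2 ≤ N by omega)
  have hpos : (0 : ℝ) ≤ (39 / 40 : ℝ) ^ ((univ.filter fun i : Fin N => i ∉ W' ∧ β i ≠ 0).card / (Nat.log 2 N) ^ C)
      * (2 : ℝ) ^ N := by positivity
  nlinarith [hpos, hN2]

/-! ## §2 The structured branch with two tolerance sets / off the high-co-degree letters -/

open scoped Classical in
/-- ★★ **STRUCTURED BRANCH, TWO TOLERANCE SETS — UNCONDITIONAL, PLAIN SCHEDULE.**  ONE `θ < 1`; for every `C` constants `D, n₀`; for `N ≥ n₀`: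
`W ⊆ W'`, `3·#W ≤ N` (no budget on `W'`), seeds `c` graded-spread off `W'` with the plain schedule `(log₂N)^C·(50(j+1) + D·log₂N)`, juntas
`H k (seed residues) x` reading `T k` with `#(T k ∖ W) ≤ (log₂N)^C`, every letter outside `W'` co-read with `< (log₂N)^C` letters outside `W'`
⇒ `≤ θ·2^{N−1}` winning odd inputs (`seedJuntaHard_of_twoTolR1` + `twistedBound_coDegree_noBudget`). -/
theorem seedJuntaHardXS_twoTol :
    ∃ θ : ℝ, θ < 1 ∧ ∀ C : ℕ, ∃ D n₀ : ℕ, ∀ N ≥ n₀,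
      ∀ (W W' : Finset (Fin N)) (R : ℕ) (c : Fin R → Fin N → ZMod 3) (T : Fin N → Finset (Fin N))
        (H : Fin N → (Fin R → ZMod 3) → (Fin N → Bool) → Bool),
        W ⊆ W' → 3 * W.card ≤ N →
        GradedSpreadOff W' c (fun j => (Nat.log 2 N) ^ C * (50 * (j.val + 1) + D * Nat.log 2 N)) →
        (∀ k, (T k \ W).card ≤ (Nat.log 2 N) ^ C) →
        (∀ i : Fin N, i ∉ W' →
          (univ.filter fun i' : Fin N => i' ≠ i ∧ i' ∉ W' ∧ ∃ k, i ∈ T k ∧ i' ∈ T k).card + 1 ≤ (Nat.log 2 N) ^ C) →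
        (∀ k v (x x' : Fin N → Bool), (∀ i ∈ T k, x i = x' i) → H k v x = H k v x') →
          ((univ.filter fun x : Fin N → Bool =>
              OddZeros x ∧ RingHLF.Rel x (fun k => H k (LinForms.resVec c x) x)).card : ℝ)
            ≤ θ * (2 : ℝ) ^ (N - 1) := by
  obtain ⟨θ, hθ, hcover⟩ := AffBells34.coverPolylogHard
  refine ⟨(1 + θ) / 2, by linarith, fun C => ?_⟩
  obtain ⟨D, n₀, hD⟩ := seedJuntaHard_of_twoTolR1
    (fun C N W' T => ∀ i : Fin N, i ∉ W' →
      (univ.filter fun i' : Fin N => i' ≠ i ∧ i' ∉ W' ∧ ∃ k, i ∈ T k ∧ i' ∈ T k).card + 1 ≤ (Nat.log 2 N) ^ C)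
    hθ hcover (ρ := 39 / 40) (α := 50) (by norm_num) three_mul_rho_pow_fifty_lt_one
    (fun C => twistedBound_coDegree_noBudget C) C
  exact ⟨D, n₀, fun N hN W W' R c T H hWW' hW hspread hT hco hH => hD N hN W W' R c T H hWW' hW hspread hT hco hH⟩

open scoped Classical in
/-- ★★ **STRUCTURED BRANCH OFF THE HIGH-CO-DEGREE LETTERS — UNCONDITIONAL, PLAIN SCHEDULE, BUDGET VERBATIM.**  ONE `θ < 1`; ∀`C` ∃`D, n₀`:
for `N ≥ n₀`, `3·#W ≤ N`, juntas `#(T k ∖ W) ≤ (log₂N)^C` (arbitrary overlaps), and seeds graded-spread, with the plain schedule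
`(log₂N)^C·(50(j+1) + D·log₂N)`, off `W ∪ {i ∉ W : i has ≥ (log₂N)^C − 1 … }` — precisely off `W ∪ H`, `H := {i ∉ W : (log₂N)^C ≤ coDeg_W(i) + 1}`
the letters co-read with at least `(log₂N)^C − 1` other letters outside `W` — the strategy `x ↦ H k (resVec c x) x` wins on `≤ θ·2^{N−1}` odd inputs.
(`seedJuntaHardXS_twoTol` with `W' = W ∪ H`; co-degrees only drop when `W` grows, `coDegree_mono`.) -/
theorem seedJuntaHardXS_offHigh :
    ∃ θ : ℝ, θ < 1 ∧ ∀ C : ℕ, ∃ D n₀ : ℕ, ∀ N ≥ n₀,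
      ∀ (W : Finset (Fin N)) (R : ℕ) (c : Fin R → Fin N → ZMod 3) (T : Fin N → Finset (Fin N))
        (H : Fin N → (Fin R → ZMod 3) → (Fin N → Bool) → Bool),
        3 * W.card ≤ N → (∀ k, (T k \ W).card ≤ (Nat.log 2 N) ^ C) →
        GradedSpreadOff (W ∪ univ.filter fun i : Fin N => i ∉ W ∧ (Nat.log 2 N) ^ C ≤
            (univ.filter fun i' : Fin N => i' ≠ i ∧ i' ∉ W ∧ ∃ k, i ∈ T k ∧ i' ∈ T k).card + 1)
          c (fun j => (Nat.log 2 N) ^ C * (50 * (j.val + 1) + D * Nat.log 2 N)) →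
        (∀ k v (x x' : Fin N → Bool), (∀ i ∈ T k, x i = x' i) → H k v x = H k v x') →
          ((univ.filter fun x : Fin N → Bool =>
              OddZeros x ∧ RingHLF.Rel x (fun k => H k (LinForms.resVec c x) x)).card : ℝ)
            ≤ θ * (2 : ℝ) ^ (N - 1) := by
  obtain ⟨θ, hθ, hall⟩ := seedJuntaHardXS_twoTol
  refine ⟨θ, hθ, fun C => ?_⟩
  obtain ⟨D, n₀, hD⟩ := hall C
  refine ⟨D, n₀, fun N hN W R c T H hW hT hspread hH => ?_⟩
  set Hi : Finset (Fin N) := univ.filter fun i : Fin N => i ∉ W ∧ (Nat.log 2 N) ^ C ≤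
      (univ.filter fun i' : Fin N => i' ≠ i ∧ i' ∉ W ∧ ∃ k, i ∈ T k ∧ i' ∈ T k).card + 1 with hHi
  have hWW' : W ⊆ W ∪ Hi := subset_union_left
  have hco : ∀ i : Fin N, i ∉ W ∪ Hi →
      (univ.filter fun i' : Fin N => i' ≠ i ∧ i' ∉ W ∪ Hi ∧ ∃ k, i ∈ T k ∧ i' ∈ T k).card + 1 ≤ (Nat.log 2 N) ^ C := by
    intro i hi
    rw [mem_union, not_or] at hi
    have hlow : (univ.filter fun i' : Fin N => i' ≠ i ∧ i' ∉ W ∧ ∃ k, i ∈ T k ∧ i' ∈ T k).card + 1 < (Nat.log 2 N) ^ C := by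
      by_contra h
      exact hi.2 (mem_filter.mpr ⟨mem_univ _, hi.1, not_lt.mp h⟩)
    have hmono := coDegree_mono T hWW' i
    omega
  exact hD N hN W (W ∪ Hi) R c T H hWW' hW hspread hT hco hH

/-! ## §3 The (J3)ˣ form with two tolerance sets -/

open LinJunta39

open scoped Classical in
/-- ★ **(J3)ˣ, STRUCTURED BRANCH WITH TWO TOLERANCE SETS — UNCONDITIONAL, plain schedule, budget `3·#W ≤ N`.**  Outputs
`tGuess x k ⊕ F k (⟨ℓ_{k,i},x⟩)_{i<r}` with ANY decomposition `ℓ_{k,i} = Σ_t a_{k,i,t} c_t + rem_{k,i}`; remainder juntas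
`T k = (⋃_i suppOff W rem_{k,i}) ∪ W ∪ {k, k+1}` (passed with its defining equation) with `#(⋃_i supp rem_{k,i} ∖ W) + 2 ≤ (log₂N)^C`; any
`W' ⊇ W` (no budget) off which every letter has `< (log₂N)^C` co-read partners in the family `T` and off which the seeds `c` are graded-spread with
the plain schedule `(log₂N)^C·(50(j+1) + D·log₂N)` ⇒ `≤ θ·2^{N−1}` winning odd inputs.  (E.g. `W' = W ∪ {letters of co-degree ≥ (log₂N)^C − 1}`,
cf. `seedJuntaHardXS_offHigh`.) -/
theorem perOutputForms_structured_twoTol :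
    ∃ θ : ℝ, θ < 1 ∧ ∀ C : ℕ, ∃ D n₀ : ℕ, ∀ N ≥ n₀,
      ∀ (W W' : Finset (Fin N)) (r : ℕ) (ℓ : Fin N → Fin r → Fin N → ZMod 3) (F : Fin N → (Fin r → ZMod 3) → Bool)
        (R : ℕ) (c : Fin R → Fin N → ZMod 3) (a : Fin N → Fin r → Fin R → ZMod 3) (rem : Fin N → Fin r → Fin N → ZMod 3)
        (T : Fin N → Finset (Fin N)),
        W ⊆ W' → 3 * W.card ≤ N →
        (∀ k i m, ℓ k i m = ∑ t, a k i t * c t m + rem k i m) →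
        (∀ k, T k = ((univ : Finset (Fin r)).biUnion fun i => suppOff W (rem k i)) ∪ W ∪ {k, nxt k}) →
        (∀ k, ((univ : Finset (Fin r)).biUnion fun i => suppOff W (rem k i)).card + 2 ≤ (Nat.log 2 N) ^ C) →
        (∀ i : Fin N, i ∉ W' →
          (univ.filter fun i' : Fin N => i' ≠ i ∧ i' ∉ W' ∧ ∃ k, i ∈ T k ∧ i' ∈ T k).card + 1 ≤ (Nat.log 2 N) ^ C) →
        GradedSpreadOff W' c (fun j => (Nat.log 2 N) ^ C * (50 * (j.val + 1) + D * Nat.log 2 N)) →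
          ((univ.filter fun x : Fin N → Bool =>
              OddZeros x ∧ RingHLF.Rel x (fun k => xor (tGuess x k) (F k (fun i => linVal (ℓ k i) x)))).card : ℝ)
            ≤ θ * (2 : ℝ) ^ (N - 1) := by
  obtain ⟨θ, hθ, hall⟩ := seedJuntaHardXS_twoTol
  refine ⟨θ, hθ, fun C => ?_⟩
  obtain ⟨D, n₀, hD⟩ := hall C
  refine ⟨D, n₀, fun N hN W W' r ℓ F R c a rem T hWW' hW hdec hTdef hr hco hspread => ?_⟩
  have hT : ∀ k, (T k \ W).card ≤ (Nat.log 2 N) ^ C := fun k => by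
    rw [hTdef k]; exact (card_union_tol_pair_sdiff_le _ W k).trans (hr k)
  have hmemT : ∀ (k : Fin N) (i : Fin r), ∀ m ∈ suppOff W (rem k i) ∪ W, m ∈ T k := by
    intro k i m hm
    rw [hTdef k]
    rw [mem_union] at hm
    rcases hm with hm | hm
    · exact mem_union_left _ (mem_union_left _ (mem_biUnion.mpr ⟨i, mem_univ _, hm⟩))
    · exact mem_union_left _ (mem_union_right _ hm)
  have hkT : ∀ k : Fin N, k ∈ T k := fun k => by rw [hTdef k]; simp
  have hkT' : ∀ k : Fin N, nxt k ∈ T k := fun k => by rw [hTdef k]; simp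
  have hH : ∀ k (v : Fin R → ZMod 3) (x x' : Fin N → Bool), (∀ m ∈ T k, x m = x' m) →
      xor (tGuess x k) (F k (fun i => ∑ t, a k i t * v t + linVal (rem k i) x))
        = xor (tGuess x' k) (F k (fun i => ∑ t, a k i t * v t + linVal (rem k i) x')) := by
    intro k v x x' hxx'
    rw [tGuess_congr k (hxx' k (hkT k)) (hxx' (nxt k) (hkT' k))]
    congr 2
    funext i
    rw [linVal_readsOnly W (rem k i) x x' fun m hm => hxx' m (hmemT k i m hm)]
  have h := hD N hN W W' R c T
    (fun k v x => xor (tGuess x k) (F k (fun i => ∑ t, a k i t * v t + linVal (rem k i) x))) hWW' hW hspread hT hco hH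
  have hlin : ∀ (k : Fin N) (i : Fin r) (x : Fin N → Bool),
      linVal (ℓ k i) x = ∑ t, a k i t * LinForms.resVec c x t + linVal (rem k i) x :=
    fun k i x => linVal_decomp c (a k i) (rem k i) (ℓ k i) (hdec k i) x
  have hset : (univ.filter fun x : Fin N → Bool =>
        OddZeros x ∧ RingHLF.Rel x (fun k => xor (tGuess x k) (F k (fun i => linVal (ℓ k i) x))))
      = univ.filter fun x : Fin N → Bool => OddZeros x ∧ RingHLF.Rel x (fun k =>
          xor (tGuess x k) (F k (fun i => ∑ t, a k i t * LinForms.resVec c x t + linVal (rem k i) x))) := by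
    refine filter_congr fun x _ => ?_
    simp only [hlin]
  rw [hset]
  exact h

end GradedSeeds38

end Summit.QuantumAdvantage.AdviceFreeQNC0

end
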